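import Mathlib
import Literature.MathematicalPhysics.QuantumFieldTheory.BalabanImbrieJaffe1984to88.BIJ85Eq712Plancherel

/-!
# `BalabanImbrieJaffe1984to88.BIJ85Eq712SymbolCalculus` — T. Bałaban, J. Imbrie, A. Jaffe, *Renormalization of the Higgs
model: minimizers, propagators and the stability of mean field theory*, Commun. Math. Phys. **97** (1985) 299–329
[BalabanImbrieJaffe1985]: Sect. 7.1 pp. 321–323 — **the symbol calculus behind (7.1.10)–(7.1.13) and (7.1.17)**: symbols of
RECTANGULAR translation-invariant operators (the averaging operators Q^e_k, Q^{e*}_k of (7.1.11) map between two field spaces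
over the same unit torus), and the rules σ_{TS}(p) = σ_T(p)σ_S(p), σ_1 = 1, σ_{T*}(p) = σ_T(p)* (and, in the sibling `BIJ85Eq712SymbolInverse`, σ_{T⁻¹} = σ_T⁻¹) by which
a configuration-space product such as (7.1.12) `σ_k = η⁻²I − Q^e_k ∂G∂* Q^{e*}_k` or (7.1.17) `τ₁ = Q^e_k(I − P_∂)Q^{e*}_k` becomes
the corresponding product of momentum-space matrices (*"by straightforward, algebraic manipulation"*, p. 322) — PROVED for all
translation-invariant operators on a finite torus; sibling of `BIJ85Eq712Plancherel` ((7.1.2), square case)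

statement-level skeleton of published theorems with citation tags; proofs where landed; nothing here is a claim about
the Yang–Mills mass gap

PDF held: `paper:balaban1985-cmp97-bij-higgs-minimizers` (journal page = PDF page + 298).  Text read: PDF pp. 23–25
(journal 321–323).

CITATION HEADER (lean-in-tree rule).  Part of the lit-balaban TYPED SKELETON (HOME `run/shared/lean/pub/lit-balaban/`); WHAT IS
REPRODUCED: supporting algebra for SKELETON rows **C1.Eq7.1.2-7.1.12** ((7.1.10)–(7.1.12): *"In terms of these functions we can
express the averaging operators Q^e_k, etc. … (7.1.11) The basic object we wish to study is σ_k, defined in (4.2.2),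
σ_k = η^{−2} − Q^e_k∂G_{k,Ax}∂*Q^{e*}_k. (7.1.12) … The operator G_k was given in the momentum representation in [6I, Eqs. (1.83)
and (1.84)]. Starting from this expression, one can derive the following formulas for σ_k(p) by straightforward, algebraic
manipulation"*, p. 322 [PDF 24]) and **C1.Eq7.1.13-7.1.19** ((7.1.17) p. 323 [PDF 25]: *"The general form of τ₁ in configuration
space is evident from (7.1.11), (7.1.14) namely τ₁ = Q^e_k(I − P_∂)Q^{e*}_k"*) of `HOME/lit-balaban-r15/ROWS-C1.md` (owner r15,
referee ref-5).  TYPED READING: as in `BIJ85Eq712Plancherel` (unit torus `Tor N` of `Balaban1983to89.B5Prop11Plancherel`, fields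
`Tor N × m → ℂ`, F⊗1 = `dftC`); an operator BETWEEN two component types, `T : Matrix (Tor N × m) (Tor N × m′) ℂ` (e.g. an
averaging operator from η-lattice fields — component index (offset in the block) × orientation, `B5Prop11Plancherel.blockEquiv` —
to unit-lattice fields), is translation invariant (`IsTranslInvR`) iff `T (x+a,i) (y+a,j) = T (x,i) (y,j)`, with the rectangular
symbol `symbR T p : Matrix m m′ ℂ`.
WHAT IS KERNEL-CHECKED (zero `sorry`, standard axioms): `dftC_mul_mul_star` ((F⊗1)T(F⊗1)^* = ⊕_p symbR T p, rectangular) and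
`eq_star_dftC_mul_fibreOpR_mul_dftC`; translation invariance of `1`, `0`, sums, differences, scalar multiples, PRODUCTS
(`IsTranslInvR.mul`) and adjoints (`IsTranslInvR.conjTranspose`); the symbol rules `symbR_one`, `symbR_zero`, `symbR_add`,
`symbR_sub`, `symbR_smul`, **`symbR_mul`** (σ_{TS} = σ_Tσ_S), **`symbR_conjTranspose`** (σ_{T*} = σ_T*); `fibreOpR_mul`,
`fibreOpR_one`, `fibreOpR_inj` (uniqueness of the momentum representation).  Inverses and the converse «every fibre operator is
translation invariant»: sibling `BIJ85Eq712SymbolInverse`.  NOT CLAIMED: the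
symbols of the concrete operators Q^e_k, ∂, G_k of (7.1.11)–(7.1.12) (their configuration-space definitions live on abstract
carriers in `BIJ85Sect4Statements`); this file is the algebra by which such symbols combine.  Unit `lit-balaban-p27` (gen 4).
-/

namespace Literature.MathematicalPhysics.QuantumFieldTheory.BalabanImbrieJaffe1984to88.BIJ85Eq712SymbolCalculus

open scoped BigOperators Matrix ComplexConjugate
open Finset Complex
open Literature.MathematicalPhysics.QuantumFieldTheory.Balaban1983to89.B5Prop11Plancherel
open Literature.MathematicalPhysics.QuantumFieldTheory.BalabanImbrieJaffe1984to88.BIJ85Eq712Plancherel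

noncomputable section

variable {d : ℕ} (N : Fin d → ℕ) [hN : ∀ μ, NeZero (N μ)]
variable (m m' m'' : Type*) [Fintype m] [DecidableEq m] [Fintype m'] [DecidableEq m'] [Fintype m''] [DecidableEq m'']

/-! ## §1 Rectangular translation-invariant operators and their symbols -/

/-- Translation invariance of an operator BETWEEN two field spaces over the same unit torus (component types `m′ → m`), e.g.
the averaging operators of (7.1.11): `T (x+a,i) (y+a,j) = T (x,i) (y,j)`. [cite: BalabanImbrieJaffe1985, (7.1.11) p.322] -/
def IsTranslInvR (T : Matrix (Tor N × m) (Tor N × m') ℂ) : Prop :=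
  ∀ (a x y : Tor N) (i : m) (j : m'), T (x + a, i) (y + a, j) = T (x, i) (y, j)

omit hN [Fintype m] [DecidableEq m] in
/-- The square case is `BIJ85Eq712Plancherel.IsTranslInv` (API). [cite: BalabanImbrieJaffe1985, (7.1.11) p.322] -/
theorem isTranslInvR_iff (T : Matrix (Tor N × m) (Tor N × m) ℂ) : IsTranslInvR N m m T ↔ IsTranslInv N m T := Iff.rfl

variable {N m m'}

omit hN [Fintype m] [DecidableEq m] [Fintype m'] [DecidableEq m'] in
/-- A translation-invariant operator is a convolution: `T((x,i),(y,j)) = T((x−y,i),(0,j))` (API).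
[cite: BalabanImbrieJaffe1985, (7.1.11) p.322] -/
theorem IsTranslInvR.apply_eq {T : Matrix (Tor N × m) (Tor N × m') ℂ} (hT : IsTranslInvR N m m' T) (x y : Tor N)
    (i : m) (j : m') : T (x, i) (y, j) = T (x - y, i) (0, j) := by
  have h := hT (-y) x y i j
  rw [add_neg_cancel, ← sub_eq_add_neg] at h
  exact h.symm

variable (N m m')

/-- The RECTANGULAR SYMBOL `σ_T(p) : Matrix m m′ ℂ` of `T` at the dual momentum `p` — the Fourier transform
`Σ_z T((z,i),(0,j)) e^{−ip·z}` of the convolution kernel (the momentum-space form of an averaging operator, (7.1.11)).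
[cite: BalabanImbrieJaffe1985, (7.1.11) p.322] -/
def symbR (T : Matrix (Tor N × m) (Tor N × m') ℂ) (p : Tor N) : Matrix m m' ℂ :=
  Matrix.of fun i j => ∑ z : Tor N, T (z, i) (0, j) * conj (chi N p z)

omit [Fintype m] [DecidableEq m] [Fintype m'] [DecidableEq m'] in
/-- entries of the rectangular symbol (API). [cite: BalabanImbrieJaffe1985, (7.1.11) p.322] -/
theorem symbR_apply (T : Matrix (Tor N × m) (Tor N × m') ℂ) (p : Tor N) (i : m) (j : m') :
    symbR N m m' T p i j = ∑ z : Tor N, T (z, i) (0, j) * conj (chi N p z) := rfl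

omit [Fintype m] [DecidableEq m] in
/-- The square case is `BIJ85Eq712Plancherel.symb` (API). [cite: BalabanImbrieJaffe1985, (7.1.11) p.322] -/
theorem symbR_eq_symb (T : Matrix (Tor N × m) (Tor N × m) ℂ) (p : Tor N) : symbR N m m T p = symb N m T p := rfl

/-- The rectangular "multiplication operator" with fibres `B(p) : Matrix m m′ ℂ`. [cite: BalabanImbrieJaffe1985, (7.1.11) p.322] -/
def fibreOpR (B : Tor N → Matrix m m' ℂ) : Matrix (Tor N × m) (Tor N × m') ℂ :=
  Matrix.of fun a b => if a.1 = b.1 then B a.1 a.2 b.2 else 0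

omit hN [Fintype m] [DecidableEq m] [Fintype m'] [DecidableEq m'] in
/-- entries of the rectangular fibre operator (API). [cite: BalabanImbrieJaffe1985, (7.1.11) p.322] -/
theorem fibreOpR_apply (B : Tor N → Matrix m m' ℂ) (p : Tor N) (i : m) (q : Tor N) (j : m') :
    fibreOpR N m m' B (p, i) (q, j) = if p = q then B p i j else 0 := rfl

omit hN [Fintype m] [DecidableEq m] in
/-- The square case is `BIJ85Eq712Plancherel.fibreOp` (API). [cite: BalabanImbrieJaffe1985, (7.1.11) p.322] -/
theorem fibreOpR_eq_fibreOp (B : Tor N → Matrix m m ℂ) : fibreOpR N m m B = fibreOp N m B := rfl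

/-! ## §2 Rectangular diagonalization `(F⊗1) T (F⊗1)^* = ⊕_p σ_T(p)` -/

/-- kernel: `F_{p,z+y} = conj(e^{ip·z}) F_{p,y}`. [folklore] -/
private theorem dft_add (p z y : Tor N) : dft N p (z + y) = conj (chi N p z) * dft N p y := by
  unfold dft
  rw [chi_add_right, map_mul]
  ring

/-- kernel: `e^{ip·a} conj(e^{ip·a}) = 1`. [folklore] -/
private theorem chi_mul_conj (p a : Tor N) : chi N p a * conj (chi N p a) = 1 := by
  rw [conj_chi, ← chi_add_left, add_neg_cancel, chi_zero_left]

/-- kernel: `e^{i(−p)·z} = e^{ip·(−z)}`. [folklore] -/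
private theorem chi_neg_comm (p z : Tor N) : chi N (-p) z = chi N p (-z) := by
  unfold chi
  refine Finset.prod_congr rfl fun μ _ => ?_
  rw [Pi.neg_apply, Pi.neg_apply, neg_mul, mul_neg]

/-- kernel: `Σ_y F_{p,y} conj F_{q,y} = δ_{pq}`. [folklore] -/
private theorem sum_dft_mul_conj (p q : Tor N) :
    ∑ y : Tor N, dft N p y * conj (dft N q y) = if p = q then 1 else 0 := by
  have h := congrFun (congrFun (dft_mul_star N) p) q
  rw [Matrix.mul_apply, Matrix.one_apply] at h
  simpa only [Matrix.star_apply, Complex.star_def] using h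

omit [Fintype m'] [DecidableEq m'] in
/-- kernel: `((F⊗1) T)((p,i), b) = Σ_x F_{p,x} T((x,i), b)`. [folklore] -/
private theorem dftC_mul_apply (T : Matrix (Tor N × m) (Tor N × m') ℂ) (p : Tor N) (i : m) (b : Tor N × m') :
    (dftC N m * T) (p, i) b = ∑ x : Tor N, dft N p x * T (x, i) b := by
  rw [Matrix.mul_apply, Fintype.sum_prod_type]
  refine Finset.sum_congr rfl fun x _ => ?_
  rw [Finset.sum_eq_single i]
  · rw [dftC_apply, if_pos rfl]
  · intro j _ hj
    rw [dftC_apply, if_neg (Ne.symm hj), zero_mul]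
  · exact fun h => absurd (Finset.mem_univ i) h

/-- kernel: `((F⊗1) T (F⊗1)^*)((p,i),(q,j)) = Σ_x Σ_y F_{p,x} T((x,i),(y,j)) conj F_{q,y}`. [folklore] -/
private theorem dftC_mul_mul_star_apply_sum (T : Matrix (Tor N × m) (Tor N × m') ℂ) (p q : Tor N) (i : m) (j : m') :
    (dftC N m * T * star (dftC N m')) (p, i) (q, j)
      = ∑ x : Tor N, ∑ y : Tor N, dft N p x * T (x, i) (y, j) * conj (dft N q y) := by
  rw [Matrix.mul_apply, Fintype.sum_prod_type]
  have h1 : ∀ y : Tor N, ∑ j' : m', (dftC N m * T) (p, i) (y, j') * (star (dftC N m')) (y, j') (q, j)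
      = (dftC N m * T) (p, i) (y, j) * conj (dft N q y) := by
    intro y
    rw [Finset.sum_eq_single j]
    · rw [Matrix.star_apply, dftC_apply, if_pos rfl, Complex.star_def]
    · intro j' _ hj'
      rw [Matrix.star_apply, dftC_apply, if_neg (Ne.symm hj'), star_zero, mul_zero]
    · exact fun h => absurd (Finset.mem_univ j) h
  simp_rw [h1, dftC_mul_apply, Finset.sum_mul]
  rw [Finset.sum_comm]

/-- **Rectangular diagonalization**: for a translation-invariant `T : (Tor N × m′ → ℂ) → (Tor N × m → ℂ)`,
`(F⊗1_m) T (F⊗1_{m′})^* = ⊕_p σ_T(p)` — the averaging operators "in terms of these functions" (7.1.11) are fibrewise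
rectangular matrices. [cite: BalabanImbrieJaffe1985, (7.1.11) p.322] -/
theorem dftC_mul_mul_star {T : Matrix (Tor N × m) (Tor N × m') ℂ} (hT : IsTranslInvR N m m' T) :
    dftC N m * T * star (dftC N m') = fibreOpR N m m' (symbR N m m' T) := by
  ext ⟨p, i⟩ ⟨q, j⟩
  rw [fibreOpR_apply, dftC_mul_mul_star_apply_sum, Finset.sum_comm]
  have h1 : ∀ y : Tor N, ∑ x : Tor N, dft N p x * T (x, i) (y, j) * conj (dft N q y)
      = ∑ z : Tor N, T (z, i) (0, j) * conj (chi N p z) * (dft N p y * conj (dft N q y)) := by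
    intro y
    refine (Fintype.sum_equiv (Equiv.addRight y) _ _ fun z => ?_).symm
    show T (z, i) (0, j) * conj (chi N p z) * (dft N p y * conj (dft N q y))
      = dft N p (z + y) * T (z + y, i) (y, j) * conj (dft N q y)
    rw [hT.apply_eq (z + y) y, add_sub_cancel_right, dft_add]
    ring
  simp_rw [h1]
  rw [Finset.sum_comm]
  simp_rw [← Finset.mul_sum, sum_dft_mul_conj]
  split_ifs with h
  · simp only [mul_one, symbR_apply]
  · simp only [mul_zero, Finset.sum_const_zero]

/-- The same, solved for `T`: `T = (F⊗1_m)^* (⊕_p σ_T(p)) (F⊗1_{m′})`. [cite: BalabanImbrieJaffe1985, (7.1.11) p.322] -/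
theorem eq_star_dftC_mul_fibreOpR_mul_dftC {T : Matrix (Tor N × m) (Tor N × m') ℂ} (hT : IsTranslInvR N m m' T) :
    T = star (dftC N m) * fibreOpR N m m' (symbR N m m' T) * dftC N m' := by
  rw [← dftC_mul_mul_star N m m' hT]
  calc T = (star (dftC N m) * dftC N m) * T * (star (dftC N m') * dftC N m') := by
          rw [star_dftC_mul, star_dftC_mul, Matrix.one_mul, Matrix.mul_one]
    _ = star (dftC N m) * (dftC N m * T * star (dftC N m')) * dftC N m' := by simp only [Matrix.mul_assoc]

/-! ## §3 Fibre operators: products, identity, injectivity -/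

omit [Fintype m] [DecidableEq m] [DecidableEq m'] [Fintype m''] [DecidableEq m''] in
/-- Fibre operators compose fibrewise: `(⊕_p B(p))(⊕_p C(p)) = ⊕_p B(p)C(p)`. [cite: BalabanImbrieJaffe1985, (7.1.12) p.322] -/
theorem fibreOpR_mul (B : Tor N → Matrix m m' ℂ) (C : Tor N → Matrix m' m'' ℂ) :
    fibreOpR N m m' B * fibreOpR N m' m'' C = fibreOpR N m m'' (fun p => B p * C p) := by
  ext ⟨p, i⟩ ⟨r, k⟩
  rw [Matrix.mul_apply, Fintype.sum_prod_type, Finset.sum_eq_single p]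
  · rw [fibreOpR_apply]
    split_ifs with h
    · subst h
      rw [Matrix.mul_apply]
      refine Finset.sum_congr rfl fun j _ => ?_
      rw [fibreOpR_apply, fibreOpR_apply, if_pos rfl, if_pos rfl]
    · refine Finset.sum_eq_zero fun j _ => ?_
      rw [fibreOpR_apply, fibreOpR_apply, if_neg h, mul_zero]
  · intro q _ hq
    refine Finset.sum_eq_zero fun j _ => ?_
    rw [fibreOpR_apply, if_neg (Ne.symm hq), zero_mul]
  · exact fun h => absurd (Finset.mem_univ p) h

omit hN [Fintype m] in
/-- The identity is the fibre operator with all fibres `1`. [cite: BalabanImbrieJaffe1985, (7.1.12) p.322] -/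
theorem fibreOpR_one : fibreOpR N m m (fun _ => (1 : Matrix m m ℂ)) = 1 := by
  ext ⟨p, i⟩ ⟨q, j⟩
  rw [fibreOpR_apply, Matrix.one_apply, Matrix.one_apply]
  by_cases h : p = q
  · subst h
    by_cases hij : i = j
    · subst hij; simp
    · simp [hij]
  · have : (p, i) ≠ (q, j) := fun e => h (Prod.mk.inj e).1
    simp [h, this]

omit hN [Fintype m] [DecidableEq m] [Fintype m'] [DecidableEq m'] in
/-- A fibre operator determines its fibres. [cite: BalabanImbrieJaffe1985, (7.1.12) p.322] -/
theorem fibreOpR_inj {B C : Tor N → Matrix m m' ℂ} (h : fibreOpR N m m' B = fibreOpR N m m' C) : B = C := by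
  funext p
  ext i j
  have h1 := congrFun (congrFun h (p, i)) (p, j)
  rwa [fibreOpR_apply, fibreOpR_apply, if_pos rfl, if_pos rfl] at h1

/-! ## §4 Translation invariance is preserved by the algebra of (7.1.12), (7.1.17) -/

omit hN [Fintype m] in
/-- `I` (the `η^{−2}I` term of (7.1.12)) is translation invariant. [cite: BalabanImbrieJaffe1985, (7.1.12) p.322] -/
theorem isTranslInvR_one : IsTranslInvR N m m (1 : Matrix (Tor N × m) (Tor N × m) ℂ) := by
  intro a x y i j
  simp only [Matrix.one_apply, Prod.mk.injEq, add_left_inj]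

omit hN [Fintype m] [DecidableEq m] [Fintype m'] [DecidableEq m'] in
/-- `0` is translation invariant. [cite: BalabanImbrieJaffe1985, (7.1.12) p.322] -/
theorem isTranslInvR_zero : IsTranslInvR N m m' (0 : Matrix (Tor N × m) (Tor N × m') ℂ) := fun _ _ _ _ _ => rfl

variable {N m m' m''}

omit hN [Fintype m] [DecidableEq m] [Fintype m'] [DecidableEq m'] in
/-- sums of translation-invariant operators are translation invariant. [cite: BalabanImbrieJaffe1985, (7.1.12) p.322] -/
theorem IsTranslInvR.add {T S : Matrix (Tor N × m) (Tor N × m') ℂ} (hT : IsTranslInvR N m m' T)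
    (hS : IsTranslInvR N m m' S) : IsTranslInvR N m m' (T + S) := fun a x y i j => by
  rw [Matrix.add_apply, Matrix.add_apply, hT, hS]

omit hN [Fintype m] [DecidableEq m] [Fintype m'] [DecidableEq m'] in
/-- differences (the `−` of (7.1.12)) are translation invariant. [cite: BalabanImbrieJaffe1985, (7.1.12) p.322] -/
theorem IsTranslInvR.sub {T S : Matrix (Tor N × m) (Tor N × m') ℂ} (hT : IsTranslInvR N m m' T)
    (hS : IsTranslInvR N m m' S) : IsTranslInvR N m m' (T - S) := fun a x y i j => by
  rw [Matrix.sub_apply, Matrix.sub_apply, hT, hS]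

omit hN [Fintype m] [DecidableEq m] [Fintype m'] [DecidableEq m'] in
/-- scalar multiples (the `η^{−2}` of (7.1.12)) are translation invariant. [cite: BalabanImbrieJaffe1985, (7.1.12) p.322] -/
theorem IsTranslInvR.smul {T : Matrix (Tor N × m) (Tor N × m') ℂ} (hT : IsTranslInvR N m m' T) (c : ℂ) :
    IsTranslInvR N m m' (c • T) := fun a x y i j => by
  rw [Matrix.smul_apply, Matrix.smul_apply, hT]

omit [Fintype m] [DecidableEq m] [DecidableEq m'] [Fintype m''] [DecidableEq m''] in
/-- PRODUCTS of translation-invariant operators (the composites `Q^e_k ∂ G ∂* Q^{e*}_k` of (7.1.12), `Q^e_k(I − P_∂)Q^{e*}_k`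
of (7.1.17)) are translation invariant. [cite: BalabanImbrieJaffe1985, (7.1.12) p.322] -/
theorem IsTranslInvR.mul {T : Matrix (Tor N × m) (Tor N × m') ℂ} {S : Matrix (Tor N × m') (Tor N × m'') ℂ}
    (hT : IsTranslInvR N m m' T) (hS : IsTranslInvR N m' m'' S) : IsTranslInvR N m m'' (T * S) := by
  intro a x y i j
  rw [Matrix.mul_apply, Matrix.mul_apply, Fintype.sum_prod_type, Fintype.sum_prod_type]
  symm
  refine Fintype.sum_equiv (Equiv.addRight a) _ _ fun w => ?_
  show ∑ k, T (x, i) (w, k) * S (w, k) (y, j) = ∑ k, T (x + a, i) (w + a, k) * S (w + a, k) (y + a, j)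
  simp only [hT a x w, hS a w y]

omit hN [Fintype m] [DecidableEq m] [Fintype m'] [DecidableEq m'] in
/-- ADJOINTS (the `Q^{e*}_k`, `∂*` of (7.1.12)) of translation-invariant operators are translation invariant.
[cite: BalabanImbrieJaffe1985, (7.1.12) p.322] -/
theorem IsTranslInvR.conjTranspose {T : Matrix (Tor N × m) (Tor N × m') ℂ} (hT : IsTranslInvR N m m' T) :
    IsTranslInvR N m' m Tᴴ := fun a x y i j => by
  rw [Matrix.conjTranspose_apply, Matrix.conjTranspose_apply, hT]

/-! ## §5 The symbol rules -/

variable (N m m')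

omit [Fintype m'] [DecidableEq m'] in
/-- kernel: `e^{ip·0} = 1`. [folklore] -/
private theorem chi_zero_right (p : Tor N) : chi N p 0 = 1 := by
  unfold chi
  simp

omit [Fintype m] in
/-- `σ_I(p) = 1` (the `η^{−2}I ↦ η^{−2}` of (7.1.12) in momentum space). [cite: BalabanImbrieJaffe1985, (7.1.12) p.322] -/
theorem symbR_one (p : Tor N) : symbR N m m (1 : Matrix (Tor N × m) (Tor N × m) ℂ) p = 1 := by
  ext i j
  rw [symbR_apply, Finset.sum_eq_single (0 : Tor N)]
  · rw [chi_zero_right, map_one, mul_one, Matrix.one_apply, Matrix.one_apply]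
    simp only [Prod.mk.injEq, true_and]
  · intro z _ hz
    rw [Matrix.one_apply, if_neg (fun e => hz (Prod.mk.inj e).1), zero_mul]
  · exact fun h => absurd (Finset.mem_univ _) h

omit [Fintype m] [DecidableEq m] [Fintype m'] [DecidableEq m'] in
/-- `σ_0(p) = 0`. [cite: BalabanImbrieJaffe1985, (7.1.12) p.322] -/
theorem symbR_zero (p : Tor N) : symbR N m m' (0 : Matrix (Tor N × m) (Tor N × m') ℂ) p = 0 := by
  ext i j
  simp [symbR_apply]

omit [Fintype m] [DecidableEq m] [Fintype m'] [DecidableEq m'] in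
/-- `σ_{T+S}(p) = σ_T(p) + σ_S(p)`. [cite: BalabanImbrieJaffe1985, (7.1.12) p.322] -/
theorem symbR_add (T S : Matrix (Tor N × m) (Tor N × m') ℂ) (p : Tor N) :
    symbR N m m' (T + S) p = symbR N m m' T p + symbR N m m' S p := by
  ext i j
  simp only [symbR_apply, Matrix.add_apply, add_mul, Finset.sum_add_distrib]

omit [Fintype m] [DecidableEq m] [Fintype m'] [DecidableEq m'] in
/-- `σ_{T−S}(p) = σ_T(p) − σ_S(p)` (the `−` of (7.1.12)). [cite: BalabanImbrieJaffe1985, (7.1.12) p.322] -/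
theorem symbR_sub (T S : Matrix (Tor N × m) (Tor N × m') ℂ) (p : Tor N) :
    symbR N m m' (T - S) p = symbR N m m' T p - symbR N m m' S p := by
  ext i j
  simp only [symbR_apply, Matrix.sub_apply, sub_mul, Finset.sum_sub_distrib]

omit [Fintype m] [DecidableEq m] [Fintype m'] [DecidableEq m'] in
/-- `σ_{cT}(p) = c σ_T(p)` (the `η^{−2}` of (7.1.12)). [cite: BalabanImbrieJaffe1985, (7.1.12) p.322] -/
theorem symbR_smul (c : ℂ) (T : Matrix (Tor N × m) (Tor N × m') ℂ) (p : Tor N) :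
    symbR N m m' (c • T) p = c • symbR N m m' T p := by
  ext i j
  simp only [symbR_apply, Matrix.smul_apply, smul_eq_mul, mul_assoc, Finset.mul_sum]

/-- **THE PRODUCT RULE** `σ_{TS}(p) = σ_T(p) σ_S(p)` for translation-invariant `T : m′ → m`, `S : m″ → m′` — the rule by which
the configuration-space products (7.1.12) `Q^e_k ∂G∂* Q^{e*}_k` and (7.1.17) `Q^e_k(I − P_∂)Q^{e*}_k` become products of momentum-space
matrices (*"by straightforward, algebraic manipulation"*). [cite: BalabanImbrieJaffe1985, (7.1.12) p.322] -/
theorem symbR_mul {T : Matrix (Tor N × m) (Tor N × m') ℂ} {S : Matrix (Tor N × m') (Tor N × m'') ℂ}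
    (hT : IsTranslInvR N m m' T) (hS : IsTranslInvR N m' m'' S) (p : Tor N) :
    symbR N m m'' (T * S) p = symbR N m m' T p * symbR N m' m'' S p := by
  have h1 := dftC_mul_mul_star N m m'' (hT.mul hS)
  have h2 : dftC N m * (T * S) * star (dftC N m'')
      = fibreOpR N m m'' (fun p => symbR N m m' T p * symbR N m' m'' S p) := by
    rw [← fibreOpR_mul, ← dftC_mul_mul_star N m m' hT, ← dftC_mul_mul_star N m' m'' hS]
    calc dftC N m * (T * S) * star (dftC N m'')
        = dftC N m * T * (star (dftC N m') * dftC N m') * S * star (dftC N m'') := by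
          rw [star_dftC_mul, Matrix.mul_one, Matrix.mul_assoc (dftC N m) T S]
      _ = dftC N m * T * star (dftC N m') * (dftC N m' * S * star (dftC N m'')) := by
          simp only [Matrix.mul_assoc]
  exact congrFun (fibreOpR_inj N m m'' (h1.symm.trans h2)) p

omit [Fintype m] [DecidableEq m] [Fintype m'] [DecidableEq m'] in
/-- **THE ADJOINT RULE** `σ_{T*}(p) = σ_T(p)*` for translation-invariant `T` (so `Q^{e*}_k`, `∂*` in (7.1.12) act fibrewise by
the conjugate-transposed symbols). [cite: BalabanImbrieJaffe1985, (7.1.12) p.322] -/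
theorem symbR_conjTranspose {T : Matrix (Tor N × m) (Tor N × m') ℂ} (hT : IsTranslInvR N m m' T) (p : Tor N) :
    symbR N m' m Tᴴ p = (symbR N m m' T p)ᴴ := by
  ext i j
  rw [Matrix.conjTranspose_apply, symbR_apply, symbR_apply, star_sum]
  refine Fintype.sum_equiv (Equiv.neg (Tor N)) _ _ fun z => ?_
  show Tᴴ (z, i) (0, j) * conj (chi N p z) = star (T (-z, j) (0, i) * conj (chi N p (-z)))
  rw [Matrix.conjTranspose_apply, hT.apply_eq 0 z j i, zero_sub, star_mul', Complex.star_def, Complex.conj_conj,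
    conj_chi, chi_neg_comm]

end

end Literature.MathematicalPhysics.QuantumFieldTheory.BalabanImbrieJaffe1984to88.BIJ85Eq712SymbolCalculus
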